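import Summits.QuantumFields.YangMills.Theorems.BalabanUVNodesK0HalvingStepSocket
import Summits.QuantumFields.YangMills.Theorems.BalabanUVNodesN07HalvingStepTopOfLocalLetters

/-!
# K0⁷ — THE LOCAL-LETTERS SOCKETS FOR STUB 1: K0⁷'s body from [15] (167) ∕ (165) in a local gauge around every top-class plaquette∕bond
# (dag-n07-w4's tokens `LocalLetters167TopStep` ∕ `LocalLetters165TopStep`) in place of Proposition 8's top step

Cell `pub-ymgap`, seat `pub-ymgap-dag-n21-c` generation 16 (K0⁷ road lineage; human ruling D-0149, director-ym LINE №197; dag-n07-w4 g0's SOCKET-ASK on the bus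
«→ dag-n21-c: SOCKET `LocalLetters165TopStep`»).  `--kind proof --supports stmt-QuantumFields-20541 --as helper`.  NEW sibling leaf of this seat's
`…K0HalvingStepSocket` (p582553); nothing modified; no new named fact (the two tokens are dag-n07-w4's, `…N07HalvingStepTopOfLocalLetters`, p584895, CONSUMED BY NAME).

WHY.  Stub 1 of K0⁷'s skeleton V18 (`stub_prop8StepCoP13`) reads `∃ B₃ a₀ a₁, 2L² ≤ B₃ ∧ 0 < a₀ ∧ 0 < a₁ ∧ Prop8RegSepTopStep F 2 suppDomOfRecord B₃ a₀ a₁`.  The chain of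
by-name reductions now in the tree is: [15] (165)-letters in a local gauge (`LocalLetters165TopStep`, budget `128C ≤ B₃`, `512θ ≤ 1`, `512·Q·a₀ ≤ 1`, `2a₀ ≤ 1`) ⟹ (167)-letters
(`LocalLetters167TopStep`) ⟹ Sect. F's one pass `HalvingStepTop` (dag-n07-w4, module 31's (168) inside) ⟹ Prop. 8's top step (dag-n07-e module 30) ⟹ stub 1's registered body
(this seat's `prop8StepCoP_of_halvingStepTop`, floor `2L² ≤ B₃` derived).  This file lands the two compositions dag-n07-w4 asked for, on the K0 road (key 20541), so that the
N07 file need not import the K0 files: a seat that discharges the (165)- or (167)-letters token for every family closes stub 1 AS REGISTERED in one line, and K0⁷'s body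
follows with stubs 2, 3ᴬ VERBATIM through Cʷ″ `record13SepCoPHBody_of_stubs123A`.  V18 is NOT re-registered (plan's call); the reduced stub-1 signatures are displayed
in §2's binders for the plan's skeleton note.

CONTENTS.  §1 `prop8StepCoP_of_localLetters167`, `prop8StepCoP_of_localLetters165` (stub 1's registered body from either token).  §2 `record13SepCoPHBody_of_localLetters167_23A`,
★ `record13SepCoPHBody_of_localLetters165_23A` (K0⁷'s body at every family from either token + stubs 2, 3ᴬ verbatim).

HONEST FRAMING: count-neutral kernel bookkeeping BY NAME; CONDITIONAL compositions whose antecedents are OPEN (A6: not inhabited here — the letters tokens are N07's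
[15] Sect. F chain (144)–(165) at NODE 00's objects, stub 2 = N05's [6] Prop. 6 at the member, stub 3ᴬ = NODE O, print-stated [I] §1 p.264 with unpublished proof
[II] p.355); nothing of Bałaban is asserted; K0⁷ OPEN; counts unmoved (typed 28∕28 · discharged 5∕27); one finite 𝕋⁴ programme at fixed ε — NOT continuum ∕ ℝ⁴ ∕ OS ∕
mass gap ∕ Clay.  [15] = Bałaban, CMP 102 (1985) 277 [Balaban1985Variational]; [6] = CMP 99 (1985) 75 [Balaban1985RegularSpaces]; [III] = CMP 119 (1988) 243
[Balaban1988Convergent]; [I] = CMP 109 (1987) 249 [Balaban1987RG1]; [II] = CMP 122 (1989) 355 [Balaban1989LargeFieldII].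
-/

noncomputable section

open scoped Matrix.Norms.L2Operator

namespace Summit.QuantumFields.YangMills.Theorems.K0LocalLettersSocket

open Literature.MathematicalPhysics.QuantumFieldTheory.Balaban1983to89
open Literature.MathematicalPhysics.QuantumFieldTheory.Balaban1983to89.Node00
open Literature.MathematicalPhysics.QuantumFieldTheory.Balaban1983to89.T4Continuum
open Literature.MathematicalPhysics.QuantumFieldTheory.Balaban1983to89.FlowStep
open Summit.QuantumFields.YangMills.BalabanUVNodes.N07HalvingStepTopOfLocalLetters
  (LocalLetters167TopStep LocalLetters165TopStep halvingStepTop_of_localLetters167 halvingStepTop_of_localLetters165)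
open Summit.QuantumFields.YangMills.Theorems.K0HalvingStepSocket (prop8StepCoP_of_halvingStepTop)
open Summit.QuantumFields.YangMills.Theorems.K0AllTorusOfStepTokensRCube (record13SepCoPHBody_of_stubs123A)

/-! ## §1  Stub 1's registered body from the (167)- and (165)-letters tokens -/

section StubOne

variable (F : T4Family)

/-- **STUB 1's REGISTERED BODY FROM THE (167)-LETTERS TOKEN**: `0 < B₃`, `0 < a₀`, `2a₀ ≤ 1`, `0 < a₁` and dag-n07-w4's `LocalLetters167TopStep F 2 suppDomOfRecord B₃ a₀ a₁`
([15] (167) in a local gauge around every plaquette∕bond of the top class, at NODE 00's objects) inhabit V18's `Prop8StepCoPAt F` — (168) and print's iteration are supplied by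
the kernel (`halvingStepTop_of_localLetters167`, module 30), the floor `2L² ≤ B₃` by the floor mode. [cite: Balaban1985Variational, (167)–(168) p.304, Prop. 8 p.304, Sect. F pp.300–304; Balaban1988Convergent, (2.6)–(2.8) pp.255–256] -/
theorem prop8StepCoP_of_localLetters167 {B₃ a₀ a₁ : ℝ} (hB₃ : 0 < B₃) (ha₀ : 0 < a₀) (ha₀' : 2 * a₀ ≤ 1) (ha₁ : 0 < a₁)
    (h : LocalLetters167TopStep F 2 (fun ν K Ω => suppDomOfRecord F ν K Ω) B₃ a₀ a₁) :
    ∃ B₃ a₀ a₁ : ℝ, 2 * (F.L : ℝ) ^ 2 ≤ B₃ ∧ 0 < a₀ ∧ 0 < a₁ ∧ Prop8RegSepTopStep F 2 (fun ν K Ω => suppDomOfRecord F ν K Ω) B₃ a₀ a₁ :=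
  prop8StepCoP_of_halvingStepTop F hB₃ ha₀ ha₁ (halvingStepTop_of_localLetters167 h hB₃.le ha₀')

/-- **STUB 1's REGISTERED BODY FROM THE (165)-LETTERS TOKEN** (dag-n07-w4's asked shape): `0 < B₃`, the budget `128·C ≤ B₃`, `512·θ ≤ 1`, `0 ≤ Q`, `512·Q·a₀ ≤ 1`, `0 < a₀`,
`2a₀ ≤ 1`, `0 < a₁` and `LocalLetters165TopStep F 2 suppDomOfRecord B₃ C θ Q a₀ a₁` ([15] (165) in a local gauge around every plaquette∕bond of the top class) inhabit V18's
`Prop8StepCoPAt F` — (166)'s threshold bookkeeping, (167)–(168) and the iteration are supplied by the kernel (`halvingStepTop_of_localLetters165`).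
[cite: Balaban1985Variational, (165)–(168) p.304, Prop. 8 p.304, Sect. F pp.300–304; Balaban1988Convergent, (2.6)–(2.8) pp.255–256] -/
theorem prop8StepCoP_of_localLetters165 {B₃ C θ Q a₀ a₁ : ℝ} (hB₃ : 0 < B₃) (hC : 128 * C ≤ B₃) (hθ : 512 * θ ≤ 1) (hQ : 0 ≤ Q)
    (ha : 512 * Q * a₀ ≤ 1) (ha₀ : 0 < a₀) (ha₀' : 2 * a₀ ≤ 1) (ha₁ : 0 < a₁)
    (h : LocalLetters165TopStep F 2 (fun ν K Ω => suppDomOfRecord F ν K Ω) B₃ C θ Q a₀ a₁) :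
    ∃ B₃ a₀ a₁ : ℝ, 2 * (F.L : ℝ) ^ 2 ≤ B₃ ∧ 0 < a₀ ∧ 0 < a₁ ∧ Prop8RegSepTopStep F 2 (fun ν K Ω => suppDomOfRecord F ν K Ω) B₃ a₀ a₁ :=
  prop8StepCoP_of_halvingStepTop F hB₃ ha₀ ha₁ (halvingStepTop_of_localLetters165 h hB₃.le hC hθ hQ ha ha₀')

end StubOne

/-! ## §2  K0⁷'s body at every family from the letters tokens, stubs 2 and 3ᴬ verbatim -/

section Composition

/-- **K0⁷'s BODY AT EVERY FAMILY FROM THE (167)-LETTERS TOKEN, STUB 2, STUB 3ᴬ**: Cʷ″ `record13SepCoPHBody_of_stubs123A` with its first binder replaced by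
`∀ F, ∃ B₃ a₀ a₁, 0 < B₃ ∧ 0 < a₀ ∧ 2a₀ ≤ 1 ∧ 0 < a₁ ∧ LocalLetters167TopStep F 2 suppDomOfRecord B₃ a₀ a₁`; `h2`, `h3A` are V18's stubs 2, 3ᴬ VERBATIM.  CONDITIONAL; K0⁷ NOT closed here.
[cite: Balaban1985Variational, (167)–(168) p.304, Prop. 8 p.304, Thm 1 (8)–(9) p.279; Balaban1985RegularSpaces, Prop. 6 p.99; Balaban1988Convergent, Thm 1 p.262, (2.6)–(2.8) pp.255–256; Balaban1987RG1, Thm 1 p.259, §1 p.264] -/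
theorem record13SepCoPHBody_of_localLetters167_23A
    (h1 : ∀ F : T4Family, ∃ B₃ a₀ a₁ : ℝ, 0 < B₃ ∧ 0 < a₀ ∧ 2 * a₀ ≤ 1 ∧ 0 < a₁ ∧
      LocalLetters167TopStep F 2 (fun ν K Ω => suppDomOfRecord F ν K Ω) B₃ a₀ a₁)
    (h2 : ∀ F : T4Family, ∃ B₁ c₁ : ℝ, 0 ≤ B₁ ∧ 0 < c₁ ∧
      (letI : CStarAlgebra (MatA 2) := {}; B8.Prop6Printed 4 (F.L : ℝ) B₁ c₁ (fun i : B8LeafModelZd.ZdIdx 4 F.L => zdCub (MatA 2) F.L i)))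
    (h3A : ∀ (F : T4Family) (B₃ B₃' a₀ a₁ : ℝ), 2 * (F.L : ℝ) ^ 2 ≤ B₃ → 0 < B₃' → 0 < a₀ → 0 < a₁ →
      VariationalThm1RegSepCoP7M F 2 B₃ a₀ a₁ →
      Gauge9RegSepTopStepR F 2 (fun ν K Ω => suppDomOfRecord F ν K Ω) (F.L ^ 3) ((11 * 4 + 3 * F.L) * F.L) B₃ B₃' a₀ a₁ →
      ∃ γ₀ ε₀ ε₂₉ β' : ℝ, 0 < γ₀ ∧ 0 < ε₀ ∧ 0 < ε₂₉ ∧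
        BetaLowerH (-β') γ₀ (betaOfRecord₁₃ F 2 (theta13OfThm1CCM F 2 3 ε₀ ε₂₉ B₃ B₃' a₀ a₁)) ∧
        BetaUpperH β' γ₀ (betaOfRecord₁₃ F 2 (theta13OfThm1CCM F 2 3 ε₀ ε₂₉ B₃ B₃' a₀ a₁))) :
    ∀ F : T4Family, ∃ θ : Stage13HParams F 2, θ.Provisos₁₃SepCoPH F 2 ∧ (θ.ZhUnity F 2 ∧ θ.SlotsNondegenerate₁₃ F 2) ∧ θ.Admissible F 2 :=
  record13SepCoPHBody_of_stubs123A (fun F => by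
    obtain ⟨B₃, a₀, a₁, hB₃, ha₀, ha₀', ha₁, h⟩ := h1 F
    exact prop8StepCoP_of_localLetters167 F hB₃ ha₀ ha₀' ha₁ h) h2 h3A

/-- **★ K0⁷'s BODY AT EVERY FAMILY FROM THE (165)-LETTERS TOKEN, STUB 2, STUB 3ᴬ** (dag-n07-w4's REDUCED stub-1 signature): Cʷ″ `record13SepCoPHBody_of_stubs123A` with its first
binder replaced by `∀ F, ∃ B₃ C θ Q a₀ a₁, 0 < B₃ ∧ 128C ≤ B₃ ∧ 512θ ≤ 1 ∧ 0 ≤ Q ∧ 512·Q·a₀ ≤ 1 ∧ 0 < a₀ ∧ 2a₀ ≤ 1 ∧ 0 < a₁ ∧ LocalLetters165TopStep F 2 suppDomOfRecord B₃ C θ Q a₀ a₁`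
(«(165)-letters in a local gauge around every top-class plaquette∕bond»); `h2`, `h3A` are V18's stubs 2, 3ᴬ VERBATIM.  CONDITIONAL; K0⁷ NOT closed here; nothing of Bałaban asserted.
[cite: Balaban1985Variational, (165)–(168) p.304, Prop. 8 p.304, Thm 1 (8)–(9) p.279; Balaban1985RegularSpaces, Prop. 6 p.99; Balaban1988Convergent, Thm 1 p.262, (2.6)–(2.8) pp.255–256; Balaban1987RG1, Thm 1 p.259, §1 p.264] -/
theorem record13SepCoPHBody_of_localLetters165_23A
    (h1 : ∀ F : T4Family, ∃ B₃ C θ Q a₀ a₁ : ℝ, 0 < B₃ ∧ 128 * C ≤ B₃ ∧ 512 * θ ≤ 1 ∧ 0 ≤ Q ∧ 512 * Q * a₀ ≤ 1 ∧ 0 < a₀ ∧ 2 * a₀ ≤ 1 ∧ 0 < a₁ ∧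
      LocalLetters165TopStep F 2 (fun ν K Ω => suppDomOfRecord F ν K Ω) B₃ C θ Q a₀ a₁)
    (h2 : ∀ F : T4Family, ∃ B₁ c₁ : ℝ, 0 ≤ B₁ ∧ 0 < c₁ ∧
      (letI : CStarAlgebra (MatA 2) := {}; B8.Prop6Printed 4 (F.L : ℝ) B₁ c₁ (fun i : B8LeafModelZd.ZdIdx 4 F.L => zdCub (MatA 2) F.L i)))
    (h3A : ∀ (F : T4Family) (B₃ B₃' a₀ a₁ : ℝ), 2 * (F.L : ℝ) ^ 2 ≤ B₃ → 0 < B₃' → 0 < a₀ → 0 < a₁ →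
      VariationalThm1RegSepCoP7M F 2 B₃ a₀ a₁ →
      Gauge9RegSepTopStepR F 2 (fun ν K Ω => suppDomOfRecord F ν K Ω) (F.L ^ 3) ((11 * 4 + 3 * F.L) * F.L) B₃ B₃' a₀ a₁ →
      ∃ γ₀ ε₀ ε₂₉ β' : ℝ, 0 < γ₀ ∧ 0 < ε₀ ∧ 0 < ε₂₉ ∧
        BetaLowerH (-β') γ₀ (betaOfRecord₁₃ F 2 (theta13OfThm1CCM F 2 3 ε₀ ε₂₉ B₃ B₃' a₀ a₁)) ∧
        BetaUpperH β' γ₀ (betaOfRecord₁₃ F 2 (theta13OfThm1CCM F 2 3 ε₀ ε₂₉ B₃ B₃' a₀ a₁))) :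
    ∀ F : T4Family, ∃ θ : Stage13HParams F 2, θ.Provisos₁₃SepCoPH F 2 ∧ (θ.ZhUnity F 2 ∧ θ.SlotsNondegenerate₁₃ F 2) ∧ θ.Admissible F 2 :=
  record13SepCoPHBody_of_stubs123A (fun F => by
    obtain ⟨B₃, C, θ, Q, a₀, a₁, hB₃, hC, hθ, hQ, ha, ha₀, ha₀', ha₁, h⟩ := h1 F
    exact prop8StepCoP_of_localLetters165 F hB₃ hC hθ hQ ha ha₀ ha₀' ha₁ h) h2 h3A

end Composition

end Summit.QuantumFields.YangMills.Theorems.K0LocalLettersSocket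

end
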